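import Literature.MathematicalPhysics.QuantumLattice.AnisotropicXYUnconditionalLongRangeOrder
import Literature.MathematicalPhysics.QuantumLattice.XYOrderGDProofs
import Literature.MathematicalPhysics.QuantumLattice.SpinHalfCasimirBound
import HarnessLib

/-!
# The hard-core lattice Bose gas: the Matsubara–Matsuda dictionary with the spin-½ XY model,
# half filling of the ground state, and Bose–Einstein condensation from the XY order-parameter floor

Topic `MathematicalPhysics/QuantumLattice`. The tree proves long-range order of the spin-½ quantum XY
model `H_K = -Σ_xΣᵢ Kᵢ(S¹_xS¹_{x+eᵢ} + S²_xS²_{x+eᵢ})` on the tori `(ℤ/Lℤ)^d`, `d ≥ 3`, with an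
explicit FLOOR on the ground-state order parameter (`xyAniso_groundOrderParameter_ge`,
`xyLayered_groundOrderParameter_ge_spinHalf` of `AnisotropicXYUnconditionalLongRangeOrder.lean`).
This file writes the DICTIONARY under which these are statements about the **hard-core lattice Bose
gas** (Matsubara–Matsuda 1956; Aizenman–Lieb–Seiringer–Solovej–Yngvason 2004, §II) and transfers
the floor to a floor on the **condensate fraction**:

* §1 `HardCoreBoson.cre / ann / num` — the hard-core boson operators `a†_x ↔ (0 1; 0 0)`,
  `a_x ↔ (0 0; 1 0)`, `n_x = a†_x a_x ↔ (1 0; 0 0)` at a site of `⊗_x ℂ²` ([AizenmanEtAl2004] §II),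
  the **Matsubara–Matsuda correspondence** `a†_x = S¹_x + iS²_x = S⁺_x`, `a_x = S⁻_x`,
  `n_x = S³_x + ½` (`cre_eq`, `ann_eq`, `num_eq`), the hard-core algebra `a_x² = 0`,
  `a_x a†_x + a†_x a_x = 1`, `n_x² = n_x`, bosonic commutation between distinct sites, and the
  hopping identity `a†_x a_y + a†_y a_x = 2(S¹_xS¹_y + S²_xS²_y)` (`hopping_eq`).
* §2 `HardCoreBoson.hamiltonian L t = -½ Σ_x Σᵢ tᵢ (a†_x a_{x+eᵢ} + a†_{x+eᵢ} a_x)` — the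
  `U = ∞`, `λ = 0` Hamiltonian (1.1) of [AizenmanEtAl2004] on `(ℤ/Lℤ)^d` with direction-dependent
  hopping amplitudes `tᵢ`; **`hamiltonian L t = xyAnisoTorus L 1 t`** (`hamiltonian_eq_xyAnisoTorus`,
  [AizenmanEtAl2004] eq. (2.1)).
* §3 **Half filling**: the particle–hole transformation `U = ⊗_x σˣ_x` exchanges `a_x ↔ a†_x`
  and commutes with `H`, so the tracial ground state has density `ω(n_x) = ½` at every site
  (`groundState_num_eq_half`; [AizenmanEtAl2004] §II: the ground state has `N = ½|Λ|`).
* §4 **BEC**: the one-body density matrix `γ(x,y) = ω(a†_x a_y)` ([AizenmanEtAl2004] eq. (2.2))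
  satisfies `Re γ(x,y) = ω(S¹_xS¹_y) + ω(S²_xS²_y)` for ALL `x, y` (`oneBodyDM_eq`; the diagonal by
  half filling), hence the XY floors read: for the layered hopping `t = (1, 1, r)`, `0 < r ≤ 2`,
  **`liminf_k |Λ_k|⁻² Σ_{x,y∈Λ_k} Re γ(x,y) ≥ 1/8 - 3823/(10080π) > 0.0042`** on the tori
  `(ℤ/2kℤ)³` (`condensateFraction_ge_layered`) — the largest eigenvalue of `γ` is `≥ 0.0042·|Λ|`,
  i.e. Bose–Einstein condensation into the constant mode in the sense of [AizenmanEtAl2004] §II —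
  and the general anisotropic floor `≥ ¼ - I_t/(2√2)` for `d ≥ 3`, `I_t < 1/√2`
  (`condensateFraction_ge`).

* §5 **Positive temperature**: the Gibbs state is at half filling for every `β`
  (`gibbsState_num_eq_half`), the thermal one-body density matrix is the thermal XY correlation
  (`thermalOneBodyDM_eq`), and the thermal KLS / Dyson–Lieb–Simon floors give BEC for `β ≥ β₀`:
  `liminf ≥ 1/8 - 869√2/10000 = 0.0021…` for the layered gas (`thermalCondensateFraction_ge_layered`)
  and `≥ 1/8 - ρ/(4√2)` for general anisotropic hopping, `I_t < ρ < 1/√2`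
  (`thermalCondensateFraction_ge`) — the `λ = 0` case of the BEC theorem of [AizenmanEtAl2004] §III.

* §6 **`T = 0`, every `d ≥ 2`** (isotropic hopping): `condensate_hasEvenTorusLRO` — off-diagonal
  long-range order of the ground states in every dimension `d ≥ 2`, in particular for the
  two-dimensional gas, from the tree's Kennedy–Lieb–Shastry theorem
  `kennedy_lieb_shastry_xy_ground_holds` (`oneBodyDM_one_eq_groundStateXYCorrTorus`).

Scope / what is NOT claimed: `λ = 0` only (no staggered potential — the `λ > 0` results and the
Mott phase of [AizenmanEtAl2004] are not formalised here), tori of even side, `d ≥ 3`; uniqueness of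
the ground state is not used or claimed (the tracial ground state is the uniform average over the
ground space); the `d = 2` statement is qualitative (`liminf > 0`), the explicit floors need `d ≥ 3`. No `sorry`, no named fact; definitions with bodies: `creMat`, `annMat`, `numMat`,
`cre`, `ann`, `num`, `hamiltonian`, `flipOp`, `oneBodyDM`, `thermalOneBodyDM`.

## References

* [MatsubaraMatsuda1956] T. Matsubara, H. Matsuda, *A lattice model of liquid helium, I*,
  Prog. Theor. Phys. 16 (1956) 569–582, §2.
* [AizenmanEtAl2004] M. Aizenman, E. H. Lieb, R. Seiringer, J. P. Solovej, J. Yngvason,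
  *Bose–Einstein quantum phase transition in an optical lattice model*, Phys. Rev. A 70 (2004)
  023612 (cond-mat/0403240), §I eq. (1.1), §II eqs. (2.1)–(2.2).
* [KLS1988PRL] T. Kennedy, E. H. Lieb, B. S. Shastry, *The XY model has long-range order for all
  spins and all dimensions greater than one*, Phys. Rev. Lett. 61 (1988) 2582–2584 (p. 2582: the
  spin-½ XY model "is equivalent to a lattice gas of hard-core bosons").
-/

noncomputable section

open Matrix Complex Finset Filter Topology
open scoped ComplexOrder

namespace Literature.MathematicalPhysics.QuantumLattice

open SpinOperators Literature.Probability.LatticeModels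

namespace HardCoreBoson

variable {Λ : Type*} [Fintype Λ] [DecidableEq Λ]

/-! ## §1 Hard-core bosons on `⊗_x ℂ²` and the Matsubara–Matsuda correspondence -/

/-- The single-site creation matrix `a† ↔ (0 1; 0 0)` (basis `0 = occupied = ↑`, `1 = empty = ↓`).
[cite: AizenmanEtAl2004, §II] -/
def creMat : Matrix (Fin 2) (Fin 2) ℂ := !![0, 1; 0, 0]

/-- The single-site annihilation matrix `a ↔ (0 0; 1 0)`. [cite: AizenmanEtAl2004, §II] -/
def annMat : Matrix (Fin 2) (Fin 2) ℂ := !![0, 0; 1, 0]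

/-- The single-site number matrix `a†a ↔ (1 0; 0 0)`. [cite: AizenmanEtAl2004, §II] -/
def numMat : Matrix (Fin 2) (Fin 2) ℂ := !![1, 0; 0, 0]

/-- The hard-core boson creation operator `a†_x` (the matrix `creMat` at site `x`, identity
elsewhere). [cite: AizenmanEtAl2004, §II] -/
def cre (x : Λ) : Op Λ 2 := onSite x creMat

/-- The hard-core boson annihilation operator `a_x`. [cite: AizenmanEtAl2004, §II] -/
def ann (x : Λ) : Op Λ 2 := onSite x annMat

/-- The boson number operator `n_x = a†_x a_x` (at most one boson per site).
[cite: AizenmanEtAl2004, §II] -/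
def num (x : Λ) : Op Λ 2 := onSite x numMat

/-- `creMat = S¹ + iS²` as `2 × 2` matrices. [cite: AizenmanEtAl2004, §II] -/
theorem creMat_eq : creMat = spinVec 1 0 + I • spinVec 1 1 := by
  rw [spinVec_one_eq_half_spinHalfPauli, spinVec_one_eq_half_spinHalfPauli]
  ext i j
  fin_cases i <;> fin_cases j <;> norm_num [creMat, spinHalfPauli, Complex.ext_iff]

/-- `annMat = S¹ - iS²`. [cite: AizenmanEtAl2004, §II] -/
theorem annMat_eq : annMat = spinVec 1 0 - I • spinVec 1 1 := by
  rw [spinVec_one_eq_half_spinHalfPauli, spinVec_one_eq_half_spinHalfPauli]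
  ext i j
  fin_cases i <;> fin_cases j <;> norm_num [annMat, spinHalfPauli, Complex.ext_iff]

/-- `numMat = S³ + ½`. [cite: AizenmanEtAl2004, §II] -/
theorem numMat_eq : numMat = spinVec 1 2 + (1 / 2 : ℂ) • 1 := by
  ext i j
  fin_cases i <;> fin_cases j <;> norm_num [numMat, spinVec_two, spinZ_apply]

/-- **Matsubara–Matsuda**: `a†_x = S¹_x + iS²_x = S⁺_x`. [cite: AizenmanEtAl2004, §II]
[cite: MatsubaraMatsuda1956, §2] -/
theorem cre_eq (x : Λ) : cre x = siteSpin 1 x 0 + I • siteSpin 1 x 1 := by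
  rw [cre, creMat_eq, onSite_add', onSite_smul']
  rfl

/-- **Matsubara–Matsuda**: `a_x = S¹_x - iS²_x = S⁻_x`. [cite: AizenmanEtAl2004, §II]
[cite: MatsubaraMatsuda1956, §2] -/
theorem ann_eq (x : Λ) : ann x = siteSpin 1 x 0 - I • siteSpin 1 x 1 := by
  rw [ann, annMat_eq, onSite_sub', onSite_smul']
  rfl

/-- **Matsubara–Matsuda**: `n_x = S³_x + ½`. [cite: AizenmanEtAl2004, §II]
[cite: MatsubaraMatsuda1956, §2] -/
theorem num_eq (x : Λ) : num x = siteSpin 1 x 2 + (1 / 2 : ℂ) • (1 : Op Λ 2) := by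
  rw [num, numMat_eq, onSite_add', onSite_smul', onSite_one']
  rfl

/-- `n_x = a†_x a_x`. [cite: AizenmanEtAl2004, §II] -/
theorem num_eq_cre_mul_ann (x : Λ) : num x = cre x * ann x := by
  rw [cre, ann, onSite_mul, num]
  congr 1
  ext i j
  fin_cases i <;> fin_cases j <;> norm_num [creMat, annMat, numMat, Matrix.mul_apply, Fin.sum_univ_two]

/-- `(a†_x)ᴴ = a_x`. [cite: AizenmanEtAl2004, §II] -/
theorem cre_conjTranspose (x : Λ) : (cre x)ᴴ = ann x := by
  rw [cre_eq, ann_eq, conjTranspose_add, conjTranspose_smul, (siteSpin_isHermitian 1 x 0).eq,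
    (siteSpin_isHermitian 1 x 1).eq, Complex.star_def, Complex.conj_I, neg_smul, sub_eq_add_neg]

/-- `(a_x)ᴴ = a†_x`. [cite: AizenmanEtAl2004, §II] -/
theorem ann_conjTranspose (x : Λ) : (ann x)ᴴ = cre x := by
  rw [← cre_conjTranspose, conjTranspose_conjTranspose]

/-- `n_x` is Hermitian. [cite: AizenmanEtAl2004, §II] -/
theorem num_isHermitian (x : Λ) : (num x).IsHermitian := by
  rw [IsHermitian, num_eq_cre_mul_ann, conjTranspose_mul, cre_conjTranspose, ann_conjTranspose]

/-- **Hard core**: `a_x a_x = 0` (no double occupancy). [cite: AizenmanEtAl2004, §II] -/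
theorem ann_mul_ann (x : Λ) : ann x * ann x = 0 := by
  rw [ann, onSite_mul]
  have : annMat * annMat = 0 := by
    ext i j
    fin_cases i <;> fin_cases j <;> norm_num [annMat, Matrix.mul_apply, Fin.sum_univ_two]
  rw [this]
  ext σ τ
  simp [onSite_apply]

/-- **Hard core**: `a†_x a†_x = 0`. [cite: AizenmanEtAl2004, §II] -/
theorem cre_mul_cre (x : Λ) : cre x * cre x = 0 := by
  rw [cre, onSite_mul]
  have : creMat * creMat = 0 := by
    ext i j
    fin_cases i <;> fin_cases j <;> norm_num [creMat, Matrix.mul_apply, Fin.sum_univ_two]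
  rw [this]
  ext σ τ
  simp [onSite_apply]

/-- The on-site (anti)commutation `a_x a†_x + a†_x a_x = 1` of hard-core bosons.
[cite: MatsubaraMatsuda1956, §2] -/
theorem ann_mul_cre_add_cre_mul_ann (x : Λ) : ann x * cre x + cre x * ann x = (1 : Op Λ 2) := by
  rw [ann, cre, onSite_mul, onSite_mul, ← onSite_add', ← onSite_one' (q := 2) x]
  congr 1
  ext i j
  fin_cases i <;> fin_cases j <;>
    norm_num [creMat, annMat, Matrix.mul_apply, Fin.sum_univ_two, Matrix.one_apply]

/-- `a_x a†_x = 1 - n_x` (the hole number). [cite: MatsubaraMatsuda1956, §2] -/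
theorem ann_mul_cre (x : Λ) : ann x * cre x = 1 - num x := by
  rw [eq_sub_iff_add_eq, num_eq_cre_mul_ann, ann_mul_cre_add_cre_mul_ann]

/-- `n_x² = n_x`: the occupation numbers are `0, 1`. [cite: AizenmanEtAl2004, §II] -/
theorem num_mul_num (x : Λ) : num x * num x = num x := by
  rw [num, onSite_mul]
  congr 1
  ext i j
  fin_cases i <;> fin_cases j <;> norm_num [numMat, Matrix.mul_apply, Fin.sum_univ_two]

/-- **Bosonic commutation between distinct sites**: `a_x a†_y = a†_y a_x` (`x ≠ y`).
[cite: MatsubaraMatsuda1956, §2] -/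
theorem ann_mul_cre_of_ne {x y : Λ} (hxy : x ≠ y) : ann x * cre y = cre y * ann x :=
  onSite_mul_onSite_comm hxy _ _

/-- `a_x a_y = a_y a_x` (`x ≠ y`). [cite: MatsubaraMatsuda1956, §2] -/
theorem ann_mul_ann_of_ne {x y : Λ} (hxy : x ≠ y) : ann x * ann y = ann y * ann x :=
  onSite_mul_onSite_comm hxy _ _

/-- `a†_x a†_y = a†_y a†_x` (`x ≠ y`). [cite: MatsubaraMatsuda1956, §2] -/
theorem cre_mul_cre_of_ne {x y : Λ} (hxy : x ≠ y) : cre x * cre y = cre y * cre x :=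
  onSite_mul_onSite_comm hxy _ _

/-- `n_x a_y = a_y n_x` (`x ≠ y`). [cite: MatsubaraMatsuda1956, §2] -/
theorem num_mul_ann_of_ne {x y : Λ} (hxy : x ≠ y) : num x * ann y = ann y * num x :=
  onSite_mul_onSite_comm hxy _ _

/-- `a†_x a_y = (S¹_xS¹_y + S²_xS²_y) + i(S²_xS¹_y - S¹_xS²_y)` (any two sites; for `x ≠ y` the
second bracket is Hermitian). [cite: AizenmanEtAl2004, §II eq. (2.1)] -/
theorem cre_mul_ann_eq (x y : Λ) :
    cre x * ann y = (siteSpin 1 x 0 * siteSpin 1 y 0 + siteSpin 1 x 1 * siteSpin 1 y 1) +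
      I • (siteSpin 1 x 1 * siteSpin 1 y 0 - siteSpin 1 x 0 * siteSpin 1 y 1) := by
  rw [cre_eq, ann_eq, add_mul, mul_sub, mul_sub, Matrix.mul_smul, Matrix.smul_mul, Matrix.smul_mul,
    Matrix.mul_smul, smul_smul, I_mul_I, neg_one_smul]
  module

/-- **The hopping term is the XY exchange**: `a†_x a_y + a†_y a_x = 2(S¹_xS¹_y + S²_xS²_y)`
(`x ≠ y`), i.e. `-½(a†_x a_y + h.c.) = -(S¹_xS¹_y + S²_xS²_y)`. [cite: AizenmanEtAl2004, §II eq. (2.1)] -/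
theorem hopping_eq {x y : Λ} (hxy : x ≠ y) :
    cre x * ann y + cre y * ann x = (2 : ℂ) • xyBond 1 x y := by
  have c00 := (siteSpin_commute_of_ne_holds 1 hxy 0 0).eq
  have c11 := (siteSpin_commute_of_ne_holds 1 hxy 1 1).eq
  have c01 := (siteSpin_commute_of_ne_holds 1 hxy 0 1).eq
  have c10 := (siteSpin_commute_of_ne_holds 1 hxy 1 0).eq
  rw [xyBond, spinBond_eq_mul_of_ne hxy, spinBond_eq_mul_of_ne hxy, cre_mul_ann_eq, cre_mul_ann_eq,
    ← c00, ← c11, ← c01, ← c10]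
  module

/-! ## §2 The hopping Hamiltonian on the torus and its identification with the XY model -/

section Torus

variable {d : ℕ} (L : ℕ) [NeZero L]

/-- The **hard-core lattice Bose gas** on the torus `(ℤ/Lℤ)^d` with direction-dependent hopping
amplitudes `tᵢ`: `H = -½ Σ_x Σᵢ tᵢ (a†_x a_{x+eᵢ} + a†_{x+eᵢ} a_x)` — eq. (1.1) of
[AizenmanEtAl2004] at `U = ∞`, `λ = 0` (for `tᵢ ≡ 1`; the kinetic energy is the lattice Laplacian
minus a chemical potential `d`). [cite: AizenmanEtAl2004, §I eq. (1.1)] -/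
def hamiltonian (t : Fin d → ℝ) : Op (TorusSite d L) 2 :=
  -(1 / 2 : ℂ) • ∑ x : TorusSite d L, ∑ i : Fin d,
    (t i : ℂ) • (cre x * ann (x + Pi.single i 1) + cre (x + Pi.single i 1) * ann x)

variable {L}

omit [NeZero L] in
/-- On a torus of side `L ≥ 2`, `x + eᵢ ≠ x`. [folklore] -/
private theorem self_ne_add_single (hL : 2 ≤ L) (x : TorusSite d L) (i : Fin d) :
    x ≠ x + Pi.single i 1 := by
  haveI : Fact (1 < L) := ⟨by omega⟩
  intro h
  have h1 := congrFun h i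
  simp only [Pi.add_apply, Pi.single_eq_same] at h1
  exact one_ne_zero ((add_eq_left).mp h1.symm)

/-- **The hard-core Bose gas IS the spin-½ XY model**: `H = H_K` with `K = t`
(`xyAnisoTorus L 1 t = -Σ_xΣᵢ tᵢ(S¹_xS¹_{x+eᵢ} + S²_xS²_{x+eᵢ})`), `L ≥ 3`.
[cite: AizenmanEtAl2004, §II eq. (2.1)] -/
theorem hamiltonian_eq_xyAnisoTorus (hL : 3 ≤ L) (t : Fin d → ℝ) :
    hamiltonian L t = xyAnisoTorus L 1 t := by
  rw [xyAnisoTorus_eq_sum L 1 hL, hamiltonian, Finset.smul_sum, ← Finset.sum_neg_distrib]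
  refine Finset.sum_congr rfl fun x _ => ?_
  rw [Finset.smul_sum, ← Finset.sum_neg_distrib]
  refine Finset.sum_congr rfl fun i _ => ?_
  rw [hopping_eq (self_ne_add_single (by omega) x i), smul_smul, smul_smul, ← neg_smul]
  congr 1
  ring

/-- The hopping Hamiltonian is Hermitian. [cite: AizenmanEtAl2004, §I eq. (1.1)] -/
theorem hamiltonian_isHermitian (t : Fin d → ℝ) : (hamiltonian L t).IsHermitian := by
  unfold hamiltonian
  refine IsHermitian.smul ?_ (by rw [isSelfAdjoint_iff]; norm_num [Complex.star_def])
  rw [IsHermitian, conjTranspose_sum]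
  refine Finset.sum_congr rfl fun x _ => ?_
  rw [conjTranspose_sum]
  refine Finset.sum_congr rfl fun i _ => ?_
  rw [conjTranspose_smul, conjTranspose_add, conjTranspose_mul, conjTranspose_mul,
    cre_conjTranspose, ann_conjTranspose, cre_conjTranspose, ann_conjTranspose, Complex.star_def,
    Complex.conj_ofReal, add_comm]

/-! ## §3 Particle–hole symmetry and half filling of the ground state -/

/-- The **particle–hole transformation** `U = ⊗_x σˣ_x = ⊗_x (a_x + a†_x)`.
[cite: AizenmanEtAl2004, §II (symmetry 2)] -/
def flipOp : Op Λ 2 := productOp fun _ : Λ => spinHalfPauli 0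

omit [Fintype Λ] [DecidableEq Λ] in
/-- `σˣ σˣᴴ = 1`. [folklore] -/
private theorem pauliX_mul_conjTranspose : spinHalfPauli 0 * (spinHalfPauli 0)ᴴ = 1 := by
  ext i j
  fin_cases i <;> fin_cases j <;> simp [spinHalfPauli, Matrix.conjTranspose, Matrix.mul_apply]

omit [Fintype Λ] [DecidableEq Λ] in
/-- `σˣᴴ σˣ = 1`. [folklore] -/
private theorem pauliX_conjTranspose_mul : (spinHalfPauli 0)ᴴ * spinHalfPauli 0 = 1 := by
  ext i j
  fin_cases i <;> fin_cases j <;> simp [spinHalfPauli, Matrix.conjTranspose, Matrix.mul_apply]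

/-- `U Uᴴ = 1`: the particle–hole transformation is unitary. [cite: AizenmanEtAl2004, §II (symmetry 2)] -/
theorem flipOp_mul_conjTranspose : (flipOp : Op Λ 2) * flipOpᴴ = 1 :=
  productOp_mul_conjTranspose fun _ => pauliX_mul_conjTranspose

/-- `Uᴴ U = 1`: the particle–hole transformation is unitary. [cite: AizenmanEtAl2004, §II (symmetry 2)] -/
theorem flipOp_conjTranspose_mul : (flipOp : Op Λ 2)ᴴ * flipOp = 1 :=
  productOp_conjTranspose_mul fun _ => pauliX_conjTranspose_mul

/-- **Particle–hole exchange**: `U a†_x Uᴴ = a_x`. [cite: AizenmanEtAl2004, §II (symmetry 2)] -/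
theorem flipOp_conj_cre (x : Λ) : flipOp * cre x * flipOpᴴ = ann x := by
  rw [flipOp, cre, productOp_conj_onSite (fun _ => pauliX_mul_conjTranspose), ann]
  congr 1
  ext i j
  fin_cases i <;> fin_cases j <;>
    simp [spinHalfPauli, creMat, annMat, Matrix.conjTranspose, Matrix.mul_apply, Fin.sum_univ_two]

/-- `U a_x Uᴴ = a†_x`. [cite: AizenmanEtAl2004, §II (symmetry 2)] -/
theorem flipOp_conj_ann (x : Λ) : flipOp * ann x * flipOpᴴ = cre x := by
  rw [flipOp, ann, productOp_conj_onSite (fun _ => pauliX_mul_conjTranspose), cre]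
  congr 1
  ext i j
  fin_cases i <;> fin_cases j <;>
    simp [spinHalfPauli, creMat, annMat, Matrix.conjTranspose, Matrix.mul_apply, Fin.sum_univ_two]

/-- `U n_x Uᴴ = 1 - n_x` (particles ↔ holes). [cite: AizenmanEtAl2004, §II (symmetry 2)] -/
theorem flipOp_conj_num (x : Λ) : flipOp * num x * flipOpᴴ = 1 - num x := by
  rw [num_eq_cre_mul_ann, flipOp, productOp_conj_mul (fun _ => pauliX_conjTranspose_mul), ← flipOp,
    flipOp_conj_cre, flipOp_conj_ann, ann_mul_cre, num_eq_cre_mul_ann]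

/-- **The hopping Hamiltonian is particle–hole symmetric**: `U H Uᴴ = H` (`L ≥ 2`).
[cite: AizenmanEtAl2004, §II (symmetry 2)] -/
theorem flipOp_conj_hamiltonian (hL : 2 ≤ L) (t : Fin d → ℝ) :
    flipOp * hamiltonian L t * flipOpᴴ = hamiltonian L t := by
  have hu : ∀ _y : TorusSite d L, (spinHalfPauli 0)ᴴ * spinHalfPauli 0 = 1 :=
    fun _ => pauliX_conjTranspose_mul
  unfold hamiltonian
  rw [Matrix.mul_smul, Matrix.smul_mul, Finset.mul_sum, Finset.sum_mul]
  congr 1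
  refine Finset.sum_congr rfl fun x _ => ?_
  rw [Finset.mul_sum, Finset.sum_mul]
  refine Finset.sum_congr rfl fun i _ => ?_
  have hne := self_ne_add_single hL x i
  rw [Matrix.mul_smul, Matrix.smul_mul, Matrix.mul_add, Matrix.add_mul, flipOp,
    productOp_conj_mul hu, productOp_conj_mul hu, ← flipOp, flipOp_conj_cre, flipOp_conj_ann,
    flipOp_conj_cre, flipOp_conj_ann, ann_mul_cre_of_ne hne, ann_mul_cre_of_ne hne.symm, add_comm]

/-- `U` commutes with `H`. [cite: AizenmanEtAl2004, §II (symmetry 2)] -/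
theorem flipOp_mul_hamiltonian (hL : 2 ≤ L) (t : Fin d → ℝ) :
    flipOp * hamiltonian L t = hamiltonian L t * flipOp := by
  have h := congrArg (· * flipOp) (flipOp_conj_hamiltonian hL t)
  simpa only [mul_assoc, flipOp_conjTranspose_mul, mul_one] using h

/-- **Half filling of the ground state**: in the tracial ground state `ω` of the hopping
Hamiltonian every site carries density `ω(n_x) = ½` (`ω(n_x) = ω(U n_x Uᴴ) = 1 - ω(n_x)`), i.e.
`N = ½|Λ|` on average — the half-filling condition of [AizenmanEtAl2004] (§II: the ground state of
(2.1) has `N = ½|Λ|`). [cite: AizenmanEtAl2004, §II] -/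
theorem groundState_num_eq_half (hL : 2 ≤ L) (t : Fin d → ℝ) (x : TorusSite d L) :
    (hamiltonian L t).groundStateFunctional (num x) = 1 / 2 := by
  have hH := hamiltonian_isHermitian (L := L) t
  have hinv := groundStateFunctional_conj_of_commute hH (flipOp_mul_hamiltonian hL t)
    flipOp_conjTranspose_mul (num x)
  rw [flipOp_conj_num, map_sub, Matrix.groundStateFunctional_one hH] at hinv
  linear_combination (-(1 / 2) : ℂ) * hinv

/-- Equivalently `ω(S³_x) = 0`: zero magnetisation of the XY ground state in the 3-direction.
[cite: AizenmanEtAl2004, §II] -/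
theorem groundState_spinThree_eq_zero (hL : 2 ≤ L) (t : Fin d → ℝ) (x : TorusSite d L) :
    (hamiltonian L t).groundStateFunctional (siteSpin 1 x 2) = 0 := by
  have h := groundState_num_eq_half hL t x
  rw [num_eq, map_add, LinearMap.map_smul, Matrix.groundStateFunctional_one (hamiltonian_isHermitian t),
    smul_eq_mul, mul_one] at h
  linear_combination h

/-! ## §4 The one-body density matrix and Bose–Einstein condensation -/

/-- The (real part of the) **one-body density matrix** `γ(x,y) = ω(a†_x a_y)` in the tracial
ground state of the hard-core Bose gas on `(ℤ/Lℤ)^d` ([AizenmanEtAl2004] eq. (2.2); `0` for the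
degenerate `L = 0`). [cite: AizenmanEtAl2004, §II eq. (2.2)] -/
def oneBodyDM (L : ℕ) (t : Fin d → ℝ) (x y : TorusSite d L) : ℝ :=
  if hL : L = 0 then 0
  else
    haveI : NeZero L := ⟨hL⟩
    ((hamiltonian L t).groundStateFunctional (cre x * ann y)).re

/-- The antisymmetric combination `S²_xS¹_y - S¹_xS²_y` is Hermitian for `x ≠ y`, so its
ground-state expectation is real. [folklore] -/
private theorem cross_isHermitian {x y : Λ} (hxy : x ≠ y) :
    (siteSpin 1 x 1 * siteSpin 1 y 0 - siteSpin 1 x 0 * siteSpin 1 y 1 : Op Λ 2).IsHermitian := by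
  rw [IsHermitian, conjTranspose_sub, conjTranspose_mul, conjTranspose_mul,
    (siteSpin_isHermitian 1 x 0).eq, (siteSpin_isHermitian 1 x 1).eq, (siteSpin_isHermitian 1 y 0).eq,
    (siteSpin_isHermitian 1 y 1).eq, (siteSpin_commute_of_ne_holds 1 hxy 1 0).eq.symm,
    (siteSpin_commute_of_ne_holds 1 hxy 0 1).eq.symm]

/-- The expectation of a Hermitian observable in the tracial ground state is real. [folklore] -/
private theorem im_groundStateFunctional_eq_zero {m : Type*} [Fintype m] [DecidableEq m]
    (A : Matrix m m ℂ) {O : Matrix m m ℂ} (hO : O.IsHermitian) :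
    (A.groundStateFunctional O).im = 0 := by
  have h := Matrix.groundStateFunctional_conjTranspose A O
  rw [hO.eq] at h
  have := congrArg Complex.im h
  rw [Complex.star_def, Complex.conj_im] at this
  linarith

/-- **The dictionary for correlations**: `Re γ(x,y) = ω(S¹_xS¹_y) + ω(S²_xS²_y)` for ALL sites
`x, y` of a torus of side `L ≥ 3` — off the diagonal by the operator identity `cre_mul_ann_eq`
(the Hermitian cross term has real expectation), on the diagonal by half filling
(`γ(x,x) = ω(n_x) = ½ = ω((S¹_x)²) + ω((S²_x)²)`). [cite: AizenmanEtAl2004, §II eqs. (2.1)–(2.2)] -/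
theorem oneBodyDM_eq (hL : 3 ≤ L) (t : Fin d → ℝ) (x y : TorusSite d L) :
    oneBodyDM L t x y = xyAnisoGroundCorr 0 L 1 t x y + xyAnisoGroundCorr 1 L 1 t x y := by
  have hL0 : L ≠ 0 := by omega
  have hH := hamiltonian_isHermitian (L := L) t
  simp only [oneBodyDM, xyAnisoGroundCorr, hL0, ↓reduceDIte, ← hamiltonian_eq_xyAnisoTorus hL]
  by_cases hxy : x = y
  · subst hxy
    rw [← num_eq_cre_mul_ann, groundState_num_eq_half (by omega) t x, siteSpin_one_mul_self,
      siteSpin_one_mul_self, LinearMap.map_smul, Matrix.groundStateFunctional_one hH]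
    norm_num
  · rw [cre_mul_ann_eq x y, map_add, map_add, LinearMap.map_smul, Complex.add_re, Complex.add_re,
      smul_eq_mul, Complex.mul_re, Complex.I_re, Complex.I_im,
      im_groundStateFunctional_eq_zero _ (cross_isHermitian hxy)]
    ring

/-- **Bose–Einstein condensation of the layered hard-core Bose gas** (hopping `1` in two
directions and `r` in the third, every `0 < r ≤ 2`, ground state, tori `(ℤ/2kℤ)³`): the
condensate fraction — the weight of the constant mode in the one-body density matrix,
`|Λ|⁻² Σ_{x,y∈Λ} Re γ(x,y)` — has `liminf ≥ 1/8 - 3823/(10080π) = 0.0042…`; in particular the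
largest eigenvalue of `γ` is of order `|Λ| = 2N`, which is BEC in the sense of [AizenmanEtAl2004] §II.
This is the Kennedy–Lieb–Shastry XY floor `xyLayered_groundOrderParameter_ge_spinHalf` read through
the Matsubara–Matsuda dictionary (`oneBodyDM_eq`). [cite: AizenmanEtAl2004, §II eq. (2.2)]
[cite: KLS1988PRL, Theorem and eq. (8)] -/
theorem condensateFraction_ge_layered {r : ℝ} (hr : 0 < r) (hr2 : r ≤ 2) :
    1 / 8 - 3823 / (10080 * Real.pi) ≤
      liminf (fun k : ℕ => (∑ x ∈ halfOpenBox 3 (2 * k), ∑ y ∈ halfOpenBox 3 (2 * k),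
        torusPullback (fun L x y => oneBodyDM L (AnisotropicRotator.layeredCoupling 1 r) x y)
          (2 * k) x y) / ((halfOpenBox 3 (2 * k)).card : ℝ) ^ 2) atTop := by
  have h := xyLayered_groundOrderParameter_ge_spinHalf hr hr2
  refine h.trans_eq (Filter.liminf_congr ?_)
  filter_upwards [Filter.eventually_ge_atTop 2] with k hk
  congr 1
  refine Finset.sum_congr rfl fun x _ => Finset.sum_congr rfl fun y _ => ?_
  haveI : NeZero (2 * k) := ⟨by omega⟩
  simp only [torusPullback_apply]
  rw [oneBodyDM_eq (by omega)]

/-- The condensate fraction of the layered hard-core Bose gas is bounded below by a POSITIVE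
constant. [cite: KLS1988PRL, Theorem] -/
theorem condensateFraction_layered_pos {r : ℝ} (hr : 0 < r) (hr2 : r ≤ 2) :
    0 < liminf (fun k : ℕ => (∑ x ∈ halfOpenBox 3 (2 * k), ∑ y ∈ halfOpenBox 3 (2 * k),
        torusPullback (fun L x y => oneBodyDM L (AnisotropicRotator.layeredCoupling 1 r) x y)
          (2 * k) x y) / ((halfOpenBox 3 (2 * k)).card : ℝ) ^ 2) atTop :=
  layered_groundOrderParameter_floor_pos.trans_le (condensateFraction_ge_layered hr hr2)

/-- **Bose–Einstein condensation, general anisotropic hopping** (`d ≥ 3`, all `tᵢ > 0`, ground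
state): whenever the Kennedy–Lieb–Shastry integral satisfies `I_t < 1/√2`, the condensate fraction
obeys `liminf_k |Λ_k|⁻² Σ_{x,y} Re γ(x,y) ≥ 2(1/8 - I_t/(4√2)) = ¼ - I_t/(2√2)` on the tori `(ℤ/2kℤ)^d`
(the tree's `xyAniso_groundOrderParameter_ge` at spin ½, through `oneBodyDM_eq`).
[cite: KLS1988PRL, Theorem and eq. (8)] [cite: AizenmanEtAl2004, §II eq. (2.2)] -/
theorem condensateFraction_ge (hd3 : 3 ≤ d) {t : Fin d → ℝ} (ht : ∀ i, 0 < t i)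
    (hI : anisoKlsIntegral t < Real.sqrt 2 / 2) :
    2 * (((1 : ℝ) / 2) ^ 2 / 2 - 1 / 2 * Real.sqrt (((1 : ℝ) / 2) ^ 2 / 2) * anisoKlsIntegral t) ≤
      liminf (fun k : ℕ => (∑ x ∈ halfOpenBox d (2 * k), ∑ y ∈ halfOpenBox d (2 * k),
        torusPullback (fun L x y => oneBodyDM L t x y) (2 * k) x y) /
          ((halfOpenBox d (2 * k)).card : ℝ) ^ 2) atTop := by
  have h := xyAniso_groundOrderParameter_ge hd3 ht (n := 1) le_rfl (by simpa using hI)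
  simp only [Nat.cast_one] at h
  refine h.trans_eq (Filter.liminf_congr ?_)
  filter_upwards [Filter.eventually_ge_atTop 2] with k hk
  congr 1
  refine Finset.sum_congr rfl fun x _ => Finset.sum_congr rfl fun y _ => ?_
  haveI : NeZero (2 * k) := ⟨by omega⟩
  simp only [torusPullback_apply]
  rw [oneBodyDM_eq (by omega)]

/-! ## §5 Positive temperature: half filling of the Gibbs state and BEC for `β ≥ β₀` -/

omit [DecidableEq Λ] in
/-- `Uᴴ = U`: the particle–hole flip is an involutive Hermitian unitary. [cite: AizenmanEtAl2004, §II (symmetry 2)] -/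
theorem flipOp_conjTranspose : (flipOp : Op Λ 2)ᴴ = flipOp := by
  rw [flipOp, productOp_conjTranspose]
  congr 1
  funext x
  ext i j
  fin_cases i <;> fin_cases j <;> simp [spinHalfPauli, Matrix.conjTranspose]

/-- **Half filling at every temperature**: in the Gibbs state of the hopping Hamiltonian
`⟨n_x⟩_β = ½` at every site (particle–hole symmetry; `L ≥ 2`). [cite: AizenmanEtAl2004, §II] -/
theorem gibbsState_num_eq_half (hL : 2 ≤ L) (β : ℝ) (t : Fin d → ℝ) (x : TorusSite d L) :
    gibbsState β (hamiltonian L t) (num x) = 1 / 2 := by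
  have hH := hamiltonian_isHermitian (L := L) t
  have h := Matrix.gibbsState_conj_of_commute (flipOp_mul_hamiltonian hL t) flipOp_conjTranspose_mul
    β (num x)
  rw [flipOp_conj_num, map_sub, gibbsState_one β _ (partitionFn_pos β hH).ne'] at h
  linear_combination (-(1 / 2) : ℂ) * h

/-- The (real part of the) **thermal one-body density matrix** `γ_β(x,y) = ⟨a†_x a_y⟩_β` of the
hard-core Bose gas on `(ℤ/Lℤ)^d` ([AizenmanEtAl2004] eq. (2.2), thermal state; `0` for `L = 0`).
[cite: AizenmanEtAl2004, §II eq. (2.2)] -/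
def thermalOneBodyDM (β : ℝ) (L : ℕ) (t : Fin d → ℝ) (x y : TorusSite d L) : ℝ :=
  if hL : L = 0 then 0
  else
    haveI : NeZero L := ⟨hL⟩
    (gibbsState β (hamiltonian L t) (cre x * ann y)).re

/-- The Gibbs expectation of a Hermitian observable is real. [folklore] -/
private theorem im_gibbsState_eq_zero {m : Type*} [Fintype m] [DecidableEq m] (β : ℝ)
    {H : Matrix m m ℂ} (hH : H.IsHermitian) {O : Matrix m m ℂ} (hO : O.IsHermitian) :
    (gibbsState β H O).im = 0 := by
  have h := Matrix.gibbsState_conjTranspose β hH O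
  rw [hO.eq] at h
  have := congrArg Complex.im h
  rw [Complex.star_def, Complex.conj_im] at this
  linarith

/-- **The thermal dictionary for correlations**: `Re γ_β(x,y) = ⟨S¹_xS¹_y⟩_β + ⟨S²_xS²_y⟩_β` for all
sites of a torus of side `L ≥ 3` (diagonal by thermal half filling).
[cite: AizenmanEtAl2004, §II eqs. (2.1)–(2.2)] -/
theorem thermalOneBodyDM_eq (hL : 3 ≤ L) (β : ℝ) (t : Fin d → ℝ) (x y : TorusSite d L) :
    thermalOneBodyDM β L t x y = xyAnisoThermalCorr β t L 1 x y := by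
  have hL0 : L ≠ 0 := by omega
  have hH := hamiltonian_isHermitian (L := L) t
  rw [xyAnisoThermalCorr_of_neZero]
  simp only [thermalOneBodyDM, gibbsSpinCorr, hL0, ↓reduceDIte, ← hamiltonian_eq_xyAnisoTorus hL]
  by_cases hxy : x = y
  · subst hxy
    rw [← num_eq_cre_mul_ann, gibbsState_num_eq_half (by omega) β t x, siteSpin_one_mul_self,
      siteSpin_one_mul_self, LinearMap.map_smul, gibbsState_one β _ (partitionFn_pos β hH).ne']
    norm_num
  · rw [cre_mul_ann_eq x y, map_add, map_add, LinearMap.map_smul, Complex.add_re, Complex.add_re,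
      smul_eq_mul, Complex.mul_re, Complex.I_re, Complex.I_im,
      im_gibbsState_eq_zero β hH (cross_isHermitian hxy)]
    ring

/-- **Bose–Einstein condensation at positive temperature, layered hard-core Bose gas** (hopping
`(1, 1, r)`, every `0 < r ≤ 2`): there is `β₀ > 0` such that for all `β ≥ β₀` the thermal condensate
fraction satisfies `liminf_k |Λ_k|⁻² Σ_{x,y} Re γ_β(x,y) ≥ 1/8 - 869√2/10000 = 0.0021…` on the tori
`(ℤ/2kℤ)³` — the `λ = 0` case of the BEC theorem of [AizenmanEtAl2004] (§III), here from the
Kennedy–Lieb–Shastry / Dyson–Lieb–Simon thermal XY floor `xyLayered_thermalOrderParameter_ge_spinHalf`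
through the dictionary `thermalOneBodyDM_eq`. [cite: AizenmanEtAl2004, §II eq. (2.2), §III]
[cite: KLS1988PRL, Theorem] -/
theorem thermalCondensateFraction_ge_layered {r : ℝ} (hr : 0 < r) (hr2 : r ≤ 2) :
    ∃ β₀ : ℝ, 0 < β₀ ∧ ∀ β : ℝ, β₀ ≤ β →
      1 / 8 - 869 * Real.sqrt 2 / 10000 ≤
        liminf (fun k : ℕ => (∑ x ∈ halfOpenBox 3 (2 * k), ∑ y ∈ halfOpenBox 3 (2 * k),
          torusPullback (fun L x y => thermalOneBodyDM β L (AnisotropicRotator.layeredCoupling 1 r) x y)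
            (2 * k) x y) / ((halfOpenBox 3 (2 * k)).card : ℝ) ^ 2) atTop := by
  obtain ⟨β₀, hβ₀, h⟩ := xyLayered_thermalOrderParameter_ge_spinHalf hr hr2
  refine ⟨β₀, hβ₀, fun β hβ => (h β hβ).trans_eq (Filter.liminf_congr ?_)⟩
  filter_upwards [Filter.eventually_ge_atTop 2] with k hk
  congr 1
  refine Finset.sum_congr rfl fun x _ => Finset.sum_congr rfl fun y _ => ?_
  haveI : NeZero (2 * k) := ⟨by omega⟩
  simp only [torusPullback_apply]
  rw [thermalOneBodyDM_eq (by omega)]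

/-- **Bose–Einstein condensation at positive temperature, general anisotropic hopping** (`d ≥ 3`,
all `tᵢ > 0`): for every `ρ` with `I_t < ρ < 1/√2` there is `β₀ > 0` such that for `β ≥ β₀` the
thermal condensate fraction is `≥ 1/8 - ρ/(4√2)` on the tori `(ℤ/2kℤ)^d`
(`xyAniso_thermalOrderParameter_ge` at spin ½, through `thermalOneBodyDM_eq`).
[cite: KLS1988PRL, Theorem] [cite: AizenmanEtAl2004, §II eq. (2.2), §III] -/
theorem thermalCondensateFraction_ge (hd3 : 3 ≤ d) {t : Fin d → ℝ} (ht : ∀ i, 0 < t i) {ρ : ℝ}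
    (hIρ : anisoKlsIntegral t < ρ) (hρ : ρ < Real.sqrt 2 / 2) :
    ∃ β₀ : ℝ, 0 < β₀ ∧ ∀ β : ℝ, β₀ ≤ β →
      ((1 : ℝ) / 2) ^ 2 / 2 - 1 / 2 * Real.sqrt (((1 : ℝ) / 2) ^ 2 / 2) * ρ ≤
        liminf (fun k : ℕ => (∑ x ∈ halfOpenBox d (2 * k), ∑ y ∈ halfOpenBox d (2 * k),
          torusPullback (fun L x y => thermalOneBodyDM β L t x y) (2 * k) x y) /
            ((halfOpenBox d (2 * k)).card : ℝ) ^ 2) atTop := by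
  obtain ⟨β₀, hβ₀, h⟩ := xyAniso_thermalOrderParameter_ge hd3 ht (n := 1) le_rfl hIρ (by simpa using hρ)
  refine ⟨β₀, hβ₀, fun β hβ => ?_⟩
  have h1 := h β hβ
  simp only [Nat.cast_one] at h1
  refine h1.trans_eq (Filter.liminf_congr ?_)
  filter_upwards [Filter.eventually_ge_atTop 2] with k hk
  congr 1
  refine Finset.sum_congr rfl fun x _ => Finset.sum_congr rfl fun y _ => ?_
  haveI : NeZero (2 * k) := ⟨by omega⟩
  simp only [torusPullback_apply]
  rw [thermalOneBodyDM_eq (by omega)]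

/-! ## §6 Every dimension `d ≥ 2` at `T = 0`: Bose–Einstein condensation of the isotropic hard-core
Bose gas from the Kennedy–Lieb–Shastry theorem -/

/-- With isotropic hopping `t ≡ 1` the hard-core Bose gas is the tree's ferromagnetic XY torus
`xyTorus d L 1` (`L ≥ 3`). [cite: KLS1988PRL, eq. (1)] [cite: AizenmanEtAl2004, §II eq. (2.1)] -/
theorem hamiltonian_one_eq_xyTorus (hL : 3 ≤ L) :
    hamiltonian L (fun _ : Fin d => (1 : ℝ)) = xyTorus d L 1 := by
  rw [hamiltonian_eq_xyAnisoTorus hL, xyAnisoTorus_one L 1 hL]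

/-- The one-body density matrix of the isotropic gas is the tree's ground-state XY correlation
`groundStateXYCorrTorus L 1` (`L ≥ 3`, all pairs of sites). [cite: KLS1988PRL, Theorem]
[cite: AizenmanEtAl2004, §II eq. (2.2)] -/
theorem oneBodyDM_one_eq_groundStateXYCorrTorus (hL : 3 ≤ L) (x y : TorusSite d L) :
    oneBodyDM L (fun _ : Fin d => (1 : ℝ)) x y = groundStateXYCorrTorus L 1 x y := by
  have hL0 : L ≠ 0 := by omega
  rw [oneBodyDM_eq hL, groundStateXYCorrTorus_of_neZero, Fin.sum_univ_two, Complex.add_re]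
  simp only [xyAnisoGroundCorr, hL0, ↓reduceDIte, xyAnisoTorus_one L 1 hL]
  rfl

/-- **Bose–Einstein condensation of the hard-core lattice Bose gas at zero temperature in every
dimension `d ≥ 2`** (in particular `d = 2`): with isotropic hopping, the tracial ground states on
the even tori `(ℤ/2kℤ)^d` have off-diagonal long-range order,
`liminf_k |Λ_k|⁻² Σ_{x,y∈Λ_k} Re⟨a†_x a_y⟩ > 0`, i.e. the one-body density matrix has an eigenvalue
of order `|Λ|` — the Kennedy–Lieb–Shastry theorem ("the spin-½ XY model, equivalently a lattice
gas of hard-core bosons at half filling, has LRO in the ground state for all `d ≥ 2`",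
`kennedy_lieb_shastry_xy_ground_holds`) read through the Matsubara–Matsuda dictionary.
[cite: KLS1988PRL, Theorem] [cite: AizenmanEtAl2004, §II eq. (2.2)] -/
theorem condensate_hasEvenTorusLRO (hd : 2 ≤ d) :
    HasEvenTorusLRO (fun L (x y : TorusSite d L) => oneBodyDM L (fun _ : Fin d => (1 : ℝ)) x y) := by
  have h := kennedy_lieb_shastry_xy_ground_holds d hd 1 le_rfl
  rw [hasEvenTorusLRO_iff] at h ⊢
  refine h.trans_eq (Filter.liminf_congr ?_)
  filter_upwards [Filter.eventually_ge_atTop 2] with k hk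
  congr 1
  refine Finset.sum_congr rfl fun x _ => Finset.sum_congr rfl fun y _ => ?_
  haveI : NeZero (2 * k) := ⟨by omega⟩
  simp only [torusPullback_apply]
  rw [oneBodyDM_one_eq_groundStateXYCorrTorus (by omega)]

end Torus

end HardCoreBoson

end Literature.MathematicalPhysics.QuantumLattice
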